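import Literature.Analysis.FluidPDE.ElgindiStabilityDecomposition
import Literature.Analysis.FluidPDE.SelfSimilarCollapseAnsatz
import HarnessLib

/-!
# The collapse exponent of Elgindi's self-similar `C^{1,α}` Euler blow-up: `ξ = (1 + δ)/α` with
# `δ = O(α)` — and what it means for viscosity

Topic `Literature/Analysis/FluidPDE`. One NAMED FACT (the printed size of the anomalous exponent
`δ` — called `λ` in Elgindi's paper — of the self-similar profile, a clause the tree's rendering of
the profile theorem deliberately omits: `Elgindi.ElgindiGhoulMasmoudi2021_stabilityCore`, clause (i),
and `Elgindi.elgindi2021_selfSimilarProfile_of_stabilityCore`, "Not vendored: uniqueness, the size of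
`δ`") plus the proved dictionary to the physical power-law collapse ansatz of
`SelfSimilarCollapseAnsatz.lean` (`selfSimilarCollapse γ`, `effectiveViscosity`).

## Sources ("p." = chunk of the held arXiv texts)

* `[Elgindi2021]` T. M. Elgindi, Ann. of Math. 194 (2021) = arXiv:1904.04795. §2 "Notation", p. 6:
  "`R` will denote `ρ^α` … `z`, on the other hand, will generally denote the self-similar radial
  variable: `z = R/(1−(1+μ)t)^{1+λ}` where `λ` and `μ` are small constants." §9, p. 30: "Let us
  search for a solution of the form `Ω = (1−(1+μ)t)⁻¹ F(R/(1−(1+μ)t)^{1+λ}, θ)` where `μ` and `λ`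
  are small real numbers." §9.5, p. 34: "(gEquationFinal)–(PolarBSLFinal) has a unique `𝓗⁴` solution
  in `B_{Cα²}(0)` … when `α` is sufficiently small. From there we also see that **`μ` and `λ` are of
  order `α`**. This gives a self similar solution … and, in particular, implies Theorem 1."
  Remark 1.3, p. 4: "The solution `ω` is exactly self-similar. That is, it takes the form
  `ω(x,t) = (1−t)⁻¹ F(x/(1−t)^ξ)` for some constant `ξ > 0`."
* `[ElgindiGhoulMasmoudi2021]` Camb. J. Math. 9 (2021) = arXiv:1910.14071, §2.3 p. 7: "there exists a
  self-similar solution `Ω = (T−t)⁻¹F(R/(T−t)^{1+δ}, θ)` where `δ` is a small real number depending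
  on `α`"; the profile equation `F + (1+δ)z∂_zF + U(Φ_F)∂_θF + αV(Φ_F)z∂_zF = 𝓡(Φ_F)F` (tree:
  `Elgindi.IsProfile α δ F Φ`). Elgindi's dilated system becomes this one with `δ = λ` after the
  normalisation `F ↦ 2F/(1+μ)` recorded by the amplitude `a` of the tree's rendering (module docstring
  of `ElgindiSelfSimilarEquations.lean`).

## The dictionary (why `ξ = (1+δ)/α`)

With `R = ρ^α` (`ρ = |x|`) the profile argument is `R/(T−t)^{1+δ} = (ρ/(T−t)^{(1+δ)/α})^α`
(`selfSimilarRadius_eq`): at time `t` the vorticity is a fixed function of `x/(T−t)^ξ`,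
`ξ = (1+δ)/α` (`Elgindi.collapseExponent`), times `(T−t)⁻¹` — the power-law collapse ansatz (SS_γ) of
`SelfSimilarCollapseAnsatz.lean` with `γ = ξ` at the level of the vorticity
(`curl_selfSimilarCollapse`: `ω = (T−t)⁻¹ (curl U)(x/(T−t)^γ)` for every `γ`). Since `δ = O(α)`,
`ξ ∼ 1/α → ∞` as `α → 0`; in particular `ξ > 1 > ½` for all small `α`
(`exists_collapseExponent_gt_one`): the collapse is faster than parabolic, the velocity scale
`(T−t)^{ξ−1} → 0`, and the effective viscosity `ν_eff(t) = ν(T−t)^{1−2ξ}` of a viscous continuation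
DIVERGES as `t ↑ T` (`tendsto_effectiveViscosity_atTop`, from the tree's
`tendsto_effectiveViscosity_atTop_of_half_lt`) — viscosity is not a perturbation along this collapse.
This is bookkeeping of printed exponents; it asserts nothing about Navier–Stokes solutions.

## What is NOT here

The value of `C` (not printed), the sign of `δ`, uniqueness of the profile, anything at `α` not small.
-/

noncomputable section

open Set Function Filter Real
open _root_.Topology
open scoped ENNReal

namespace Literature.Analysis.FluidPDE

namespace Elgindi

/-! ### The exponent and the radial dictionary -/

/-- The physical **collapse exponent** `ξ = (1 + δ)/α` of the self-similar vorticity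
`Ω = (T−t)⁻¹F(ρ^α/(T−t)^{1+δ}, θ)`: the spatial scale is `(T−t)^ξ` (Elgindi 2021, Remark 1.3:
"`ω(x,t) = (1−t)⁻¹F(x/(1−t)^ξ)` for some constant `ξ > 0`"; §2 p. 6: `z = R/(1−(1+μ)t)^{1+λ}`,
`R = ρ^α`). [cite: Elgindi2021AnnMath, Remark 1.3 (p. 4 of arXiv:1904.04795) and §2 (p. 6)] -/
def collapseExponent (α δ : ℝ) : ℝ :=
  (1 + δ) / α

/-- Unfolding `collapseExponent`. [cite: Elgindi2021AnnMath, Remark 1.3 (p. 4)] -/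
@[simp] theorem collapseExponent_apply (α δ : ℝ) : collapseExponent α δ = (1 + δ) / α := rfl

/-- **The radial dictionary** `ρ^α/s^{1+δ} = (ρ/s^{(1+δ)/α})^α` for `ρ ≥ 0`, `s > 0`, `α ≠ 0`: the
self-similar variable `z = R/(T−t)^{1+δ}`, `R = ρ^α`, is the `α`-th power of the physical similarity
variable `ρ/(T−t)^ξ`, `ξ = (1+δ)/α` (Elgindi 2021 §2, p. 6; Remark 1.3). [cite: Elgindi2021AnnMath, §2 (p. 6) and Remark 1.3 (p. 4)] -/
theorem selfSimilarRadius_eq {α δ ρ s : ℝ} (hα : α ≠ 0) (hρ : 0 ≤ ρ) (hs : 0 < s) :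
    ρ ^ α / s ^ (1 + δ) = (ρ / s ^ collapseExponent α δ) ^ α := by
  rw [collapseExponent_apply, Real.div_rpow hρ (Real.rpow_nonneg hs.le _), ← Real.rpow_mul hs.le,
    div_mul_cancel₀ _ hα]

/-- With the dictionary, a profile evaluated in the `(R, θ)` self-similar variable is a fixed function
of the physical similarity variable `ρ/(T−t)^ξ`: `F(ρ^α/(T−t)^{1+δ}, θ) = F((ρ/(T−t)^ξ)^α, θ)`,
`t < T`. [cite: Elgindi2021AnnMath, Remark 1.3 (p. 4) and §9 (p. 30)] -/
theorem profile_selfSimilar_arg {α δ T t ρ : ℝ} (F : ℝ → ℝ → ℝ) (θ : ℝ) (hα : α ≠ 0) (hρ : 0 ≤ ρ)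
    (ht : t < T) :
    F (ρ ^ α / (T - t) ^ (1 + δ)) θ = F ((ρ / (T - t) ^ collapseExponent α δ) ^ α) θ := by
  rw [selfSimilarRadius_eq hα hρ (sub_pos.2 ht)]

/-! ### The named fact: `δ = O(α)` -/

/-- **The anomalous exponent of Elgindi's profile is of order `α`** (Elgindi, Ann. of Math. 194
(2021), §9.5, p. 34 of arXiv:1904.04795: the `g`-equation "has a unique `𝓗⁴` solution in `B_{Cα²}(0)`
and vanishing on `θ = 0` and `θ = π/2` when `α` is sufficiently small. From there we also see that
`μ` and `λ` are of order `α`. This gives a self similar solution"; the ansatz §9 p. 30,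
`Ω = (1−(1+μ)t)⁻¹F(R/(1−(1+μ)t)^{1+λ}, θ)`, `F = F_* + g`; recalled in Elgindi–Ghoul–Masmoudi 2021
§2.3 p. 7 as `Ω = (T−t)⁻¹F(R/(T−t)^{1+δ}, θ)`, "`δ` is a small real number depending on `α`",
`F = F_* + α²g`, `|g|_{𝓗ᵏ} ≤ C`). **Rendering**: clause (i) of the tree's
`ElgindiGhoulMasmoudi2021_stabilityCore` (the profile `(F, Φ_F)` solving `Elgindi.IsProfile α δ`,
`C⁴` in the open quarter strip, continuous up to `θ ∈ {0, π/2}` and vanishing there, amplitude `a`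
with `|a − 1| ≤ Cα`, `|F − aF_*|_{𝓗⁴} ≤ Cα²`, `L₁₂(F − aF_*)(0) = 0`) WITH the additional printed
clause `|δ| ≤ Cα` (Elgindi's `λ`; `δ = λ` under the normalisation `F ↦ 2F/(1+μ)` explained in
`ElgindiSelfSimilarEquations.lean`): there are `C` and `α₀ > 0` such that for every `0 < α < α₀`
such `δ`, `F`, `Φ_F`, `a` exist with `|δ| ≤ Cα`. The projection onto the tree's rendering of the
profile theorem is `selfSimilarExponentOrder.profile`. Not vendored: the sign of `δ`, the value of
`C`, uniqueness. [cite: Elgindi2021AnnMath, §9.5 (p. 34 of arXiv:1904.04795): "μ and λ are of order α"; §9 (p. 30); §2 (p. 6); Remark 1.3 (p. 4)]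
[cite: ElgindiGhoulMasmoudi2021, §2.3 (p. 7 of arXiv:1910.14071): the recalled profile, δ small depending on α] -/
def selfSimilarExponentOrder : Prop :=
  ∃ C α₀ : ℝ, 0 < α₀ ∧ ∀ α : ℝ, 0 < α → α < α₀ →
    ∃ (δ : ℝ) (F Φ : ℝ → ℝ → ℝ), IsProfile α δ F Φ ∧
      ContDiffOn ℝ 4 (uncurry F) strip ∧
      ContinuousOn (uncurry F) (Set.Ioi 0 ×ˢ Set.Icc 0 (π / 2)) ∧
      (∀ z, 0 < z → F z 0 = 0 ∧ F z (π / 2) = 0) ∧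
      (∃ a : ℝ, |a - 1| ≤ C * α ∧
        eHkNorm α 4 (F - a • fundamentalProfile α) ≤ ENNReal.ofReal (C * α ^ 2) ∧
        L12 (F - a • fundamentalProfile α) 0 = 0) ∧
      |δ| ≤ C * α

/-- Projection: the fact contains the tree's rendering of Elgindi's profile theorem (the conclusion
of `elgindi2021_selfSimilarProfile_of_stabilityCore`, verbatim), forgetting the size of `δ`.
[cite: Elgindi2021AnnMath, §9.5 (p. 34)] -/
theorem selfSimilarExponentOrder.profile (h : selfSimilarExponentOrder) :
    ∃ C α₀ : ℝ, 0 < α₀ ∧ ∀ α : ℝ, 0 < α → α < α₀ →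
      ∃ (δ : ℝ) (F Φ : ℝ → ℝ → ℝ), IsProfile α δ F Φ ∧
        ContDiffOn ℝ 4 (uncurry F) strip ∧
        ContinuousOn (uncurry F) (Set.Ioi 0 ×ˢ Set.Icc 0 (π / 2)) ∧
        (∀ z, 0 < z → F z 0 = 0 ∧ F z (π / 2) = 0) ∧
        ∃ a : ℝ, |a - 1| ≤ C * α ∧
          eHkNorm α 4 (F - a • fundamentalProfile α) ≤ ENNReal.ofReal (C * α ^ 2) ∧
          L12 (F - a • fundamentalProfile α) 0 = 0 := by
  obtain ⟨C, α₀, hα₀, H⟩ := h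
  refine ⟨C, α₀, hα₀, fun α hα hαα₀ => ?_⟩
  obtain ⟨δ, F, Φ, hP, h4, hc, hbc, ha, -⟩ := H α hα hαα₀
  exact ⟨δ, F, Φ, hP, h4, hc, hbc, ha⟩

/-! ### Consequences: the collapse is faster than parabolic for small `α` -/

/-- If `|δ| ≤ Cα` and `0 < α < 1/(|C| + 1)` then the collapse exponent exceeds `1`:
`(1+δ)/α ≥ (1 − |C|α)/α = 1/α − |C| > 1`. [cite: Elgindi2021AnnMath, §9.5 (p. 34) with Remark 1.3 (p. 4)] -/
theorem one_lt_collapseExponent {C α δ : ℝ} (hα : 0 < α) (hαC : α < 1 / (|C| + 1))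
    (hδ : |δ| ≤ C * α) : 1 < collapseExponent α δ := by
  rw [collapseExponent_apply, lt_div_iff₀ hα, one_mul]
  have hC1 : 0 < |C| + 1 := by positivity
  have h1 : α * (|C| + 1) < 1 := by rwa [lt_div_iff₀ hC1] at hαC
  have h2 : -δ ≤ |C| * α := (neg_le_abs δ).trans (hδ.trans (by gcongr; exact le_abs_self C))
  nlinarith

/-- In particular the exponent exceeds Leray's `½`. [cite: Elgindi2021AnnMath, §9.5 (p. 34) with Remark 1.3 (p. 4)] -/
theorem half_lt_collapseExponent {C α δ : ℝ} (hα : 0 < α) (hαC : α < 1 / (|C| + 1))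
    (hδ : |δ| ≤ C * α) : 1 / 2 < collapseExponent α δ :=
  lt_trans (by norm_num) (one_lt_collapseExponent hα hαC hδ)

/-- **From the fact: for all small `α`, Elgindi's profile collapses with exponent `ξ = (1+δ)/α > 1`**
(hence faster than the parabolic rate `½`). [cite: Elgindi2021AnnMath, §9.5 (p. 34) with Remark 1.3 (p. 4)] -/
theorem selfSimilarExponentOrder.exists_collapseExponent_gt_one (h : selfSimilarExponentOrder) :
    ∃ α₁ : ℝ, 0 < α₁ ∧ ∀ α : ℝ, 0 < α → α < α₁ →
      ∃ (δ : ℝ) (F Φ : ℝ → ℝ → ℝ), IsProfile α δ F Φ ∧ 1 < collapseExponent α δ := by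
  obtain ⟨C, α₀, hα₀, H⟩ := h
  refine ⟨min α₀ (1 / (|C| + 1)), lt_min hα₀ (by positivity), fun α hα hα₁ => ?_⟩
  obtain ⟨δ, F, Φ, hP, -, -, -, -, hδ⟩ := H α hα (hα₁.trans_le (min_le_left _ _))
  exact ⟨δ, F, Φ, hP, one_lt_collapseExponent hα (hα₁.trans_le (min_le_right _ _)) hδ⟩

/-- **Viscosity is dominant along the Elgindi collapse.** For an exponent `ξ` with `½ < ξ` (in
particular `ξ = (1+δ)/α` with `|δ| ≤ Cα`, `α` small) and any `ν > 0`, the effective viscosity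
`ν_eff(t) = ν(T−t)^{1−2ξ}` of the power-law collapse ansatz with exponent `ξ` (tree:
`effectiveViscosity`, the coefficient of `ΔU` in `ns_momentum_selfSimilarCollapse`) tends to `+∞` as
`t ↑ T` — the tree's `tendsto_effectiveViscosity_atTop_of_half_lt` at `γ = ξ`. Bookkeeping of
exponents only. [cite: Elgindi2021AnnMath, §9.5 (p. 34) with Remark 1.3 (p. 4)] -/
theorem tendsto_effectiveViscosity_atTop {C α δ ν : ℝ} (T : ℝ) (hα : 0 < α)
    (hαC : α < 1 / (|C| + 1)) (hδ : |δ| ≤ C * α) (hν : 0 < ν) :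
    Tendsto (effectiveViscosity ν (collapseExponent α δ) T) (𝓝[<] T) atTop :=
  tendsto_effectiveViscosity_atTop_of_half_lt (half_lt_collapseExponent hα hαC hδ) hν

/-- **The velocity amplitude of a faster-than-parabolic collapse vanishes**: for `ξ > 1` the velocity
scale `(T−t)^{ξ−1}` of the ansatz `u = (T−t)^{ξ−1}U(x/(T−t)^ξ)` (`selfSimilarCollapse ξ T U`) tends to
`0` as `t ↑ T`; so a bounded profile gives `sup_x ‖u(t,x)‖ → 0` — no Leray-type lower bound
`c/√(T−t)` (cf. the tree's `not_frequently_leray_lower_bound_of_half_lt`). [cite: Elgindi2021AnnMath, Remark 1.3 (p. 4) with §9.5 (p. 34)] -/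
theorem tendsto_velocityScale_zero {ξ : ℝ} (T : ℝ) (hξ : 1 < ξ) :
    Tendsto (fun t : ℝ => (T - t) ^ (ξ - 1)) (𝓝[<] T) (𝓝 0) := by
  have h1 : Tendsto (fun t : ℝ => T - t) (𝓝[<] T) (𝓝 0) := by
    have : Tendsto (fun t : ℝ => T - t) (𝓝 T) (𝓝 (T - T)) :=
      (continuous_const.sub continuous_id).tendsto T
    rw [sub_self] at this
    exact this.mono_left nhdsWithin_le_nhds
  have h2 : ContinuousAt (fun s : ℝ => s ^ (ξ - 1)) 0 :=
    Real.continuousAt_rpow_const 0 _ (Or.inr (by linarith))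
  have h3 := h2.tendsto.comp h1
  rwa [Function.comp_def, Real.zero_rpow (by linarith : (ξ : ℝ) - 1 ≠ 0)] at h3

end Elgindi

end Literature.Analysis.FluidPDE
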